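import Literature.NumberTheory.CubicFields.IntegerMatrixForms
import Mathlib.Data.Rat.Lemmas
import Mathlib.Algebra.Field.Basic
import Mathlib.Tactic.LinearCombination
import Mathlib.Tactic.FieldSimp
import HarnessLib

/-!
# The four elements `θᵢ = (gᵢ + aᵢ√D)/2` attached to an integer-matrix binary cubic form (Bhargava, HCL I, Thm 13)

Topic `Literature/NumberTheory/CubicFields`, continuing `IntegerMatrixForms.lean` (`V*`, `disc`,
the cubic covariant `g`). Second step of the class-field-theory-free road to the
Davenport–Heilbronn theorem on `Cl(K)[3]` (Bhargava–Varma 2016, §2): the field-level algebra of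
Bhargava's parametrization of 3-torsion ideal classes of quadratic rings by `SL₂(ℤ)`-orbits of
integer-matrix binary cubic forms.

Bhargava, *Higher composition laws I*, proof of Thm 13: to `C = a₀x³ + 3a₁x²y + 3a₂xy² + a₃y³`
of discriminant `D` one attaches the system (21)
`α³ = δ(c₀ + a₀τ)`, `α²β = δ(c₁ + a₁τ)`, `αβ² = δ(c₂ + a₂τ)`, `β³ = δ(c₃ + a₃τ)` in the quadratic
ring `ℤ[τ]`, `τ = (ε + √D)/2`, whose consistency is "the associativity and commutativity of `S`
implies `(α²β)² = α³ · αβ²` and `(αβ²)² = α²β · β³`", solved by the displayed `c₀, …, c₃`; and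
(23) "`α : β = (c₁ + a₁τ) : (c₂ + a₂τ)`". Writing `θᵢ := cᵢ + aᵢτ = (gᵢ + aᵢ√D)/2` with the cubic
covariant `g` of `IntegerMatrixForms.lean`, this file proves, in ANY field `K` of characteristic
`0` with a chosen `s`, `s² = D = disc C` (the four values packaged as an integer-matrix form
`thetaForm C s ∈ V*(K)`, `θᵢ = (thetaForm C s).aᵢ`):

* `thetaForm_a₀_mul_a₂`, `thetaForm_a₁_mul_a₃`, `thetaForm_a₀_mul_a₃` — **`θ₀θ₂ = θ₁²`,
  `θ₁θ₃ = θ₂²`, `θ₀θ₃ = θ₁θ₂`** (the two displayed consistency identities and their consequence),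
  from the syzygies of `IntegerMatrixForms`;
* `cube_linear_eq` — **the system (21) with `α = θ₁`, `β = θ₂`, `δ = θ₁θ₂`**: for all `x, y`,
  `(xθ₁ + yθ₂)³ = θ₁θ₂ · (θ₀x³ + 3θ₁x²y + 3θ₂xy² + θ₃y³)`, and
  `2(θ₀x³ + 3θ₁x²y + 3θ₂xy² + θ₃y³) = g(x,y) + C(x,y)·s` (`two_mul_eval_thetaForm`) — Bhargava's
  basis-free description "`C(x,y) = π((αx + βy)³/δ)`" (`π` = the `τ`-coordinate);
* `thetaForm_subst` — **equivariance**: `θ(C ∘ γ) = θ(C) ∘ γ` for every integral `γ` with `det γ = 1`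
  ("changing `α, β` … via `T ∈ SL₂(ℤ)` simply changes `C(x,y)` by that same element `T`");
* `thetaForm_ne_zero` — if `D` is not a square (e.g. a fundamental discriminant) then every
  `θᵢ ≠ 0` (so `δ = θ₁θ₂ ≠ 0` and `α, β` are independent: the nondegenerate case of Thm 13).

All statements are proved; the ideal `I = ℤθ₁ + ℤθ₂ ⊆ 𝓞_K`, the relation `I³ = (θ₁θ₂)` and the
resulting 3-torsion ideal class are in the sequel `ThreeTorsionParametrizationIdeal.lean`.

## References

* M. Bhargava, *Higher composition laws I*, Ann. of Math. 159 (2004), §3.4, Thm 13 and its proof,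
  eqs. (21)–(24) [Bhargava2004HCL1].
* M. Bhargava, I. Varma, *The mean number of 3-torsion elements in the class groups and ideal
  groups of quadratic orders*, Proc. LMS 112 (2016) = arXiv:1401.5875, §2.1, Thm 9 and (4)–(7)
  [BhargavaVarma2016].
-/

namespace Literature.NumberTheory.CubicFields

namespace SymCubic

variable {K : Type*} [Field K]

/-! ### The four values `θᵢ` -/

/-- The four elements `θᵢ = (gᵢ + aᵢ s)/2` of a field `K ∋ s` (meant: `s² = D = disc C`,
`K = ℚ(√D)`) attached to an integral integer-matrix form `C`, packaged as an integer-matrix form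
over `K`: `θᵢ = cᵢ + aᵢτ` for `τ = (ε + s)/2` and Bhargava's `cᵢ = (gᵢ − εaᵢ)/2` (HCL I, proof of
Thm 13, the right-hand sides of (21) divided by `δ`). [cite: Bhargava2004HCL1, §3.4 (proof of Theorem 13, eqs. (21) and (23))] -/
def thetaForm (C : SymCubic ℤ) (s : K) : SymCubic K :=
  ⟨((C.gCov.a₀ : K) + (C.a₀ : K) * s) / 2, ((C.gCov.a₁ : K) + (C.a₁ : K) * s) / 2,
    ((C.gCov.a₂ : K) + (C.a₂ : K) * s) / 2, ((C.gCov.a₃ : K) + (C.a₃ : K) * s) / 2⟩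

/-- `θ₀ = (g₀ + a₀s)/2` (definitional). [folklore] -/
@[simp] theorem thetaForm_a₀ (C : SymCubic ℤ) (s : K) :
    (C.thetaForm s).a₀ = ((C.gCov.a₀ : K) + (C.a₀ : K) * s) / 2 := rfl
/-- `θ₁ = (g₁ + a₁s)/2` (definitional). [folklore] -/
@[simp] theorem thetaForm_a₁ (C : SymCubic ℤ) (s : K) :
    (C.thetaForm s).a₁ = ((C.gCov.a₁ : K) + (C.a₁ : K) * s) / 2 := rfl
/-- `θ₂ = (g₂ + a₂s)/2` (definitional). [folklore] -/
@[simp] theorem thetaForm_a₂ (C : SymCubic ℤ) (s : K) :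
    (C.thetaForm s).a₂ = ((C.gCov.a₂ : K) + (C.a₂ : K) * s) / 2 := rfl
/-- `θ₃ = (g₃ + a₃s)/2` (definitional). [folklore] -/
@[simp] theorem thetaForm_a₃ (C : SymCubic ℤ) (s : K) :
    (C.thetaForm s).a₃ = ((C.gCov.a₃ : K) + (C.a₃ : K) * s) / 2 := rfl

section Identities

variable [CharZero K] (C : SymCubic ℤ) {s : K} (hs : s ^ 2 = (C.disc : K))
include hs

/-- **`θ₀θ₂ = θ₁²`** — "`(α²β)² = α³ · αβ²`" (HCL I, proof of Thm 13), from the syzygy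
`g₀g₂ − g₁² = D·A` and `a₀g₂ + a₂g₀ = 2a₁g₁`. [cite: Bhargava2004HCL1, §3.4 (proof of Theorem 13: (α²β)² = α³·αβ²)] -/
theorem thetaForm_a₀_mul_a₂ : (C.thetaForm s).a₀ * (C.thetaForm s).a₂ = (C.thetaForm s).a₁ ^ 2 := by
  have h1 : ((C.gCov.a₀ : K)) * (C.gCov.a₂ : K) - (C.gCov.a₁ : K) ^ 2
      = (C.disc : K) * ((C.a₁ : K) ^ 2 - (C.a₀ : K) * (C.a₂ : K)) := by
    have := congrArg (Int.cast : ℤ → K) (gCov_syzygy₀₂ C)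
    push_cast at this
    simpa [hess] using this
  have h2 : (C.a₀ : K) * (C.gCov.a₂ : K) + (C.a₂ : K) * (C.gCov.a₀ : K)
      = 2 * (C.a₁ : K) * (C.gCov.a₁ : K) := by
    exact_mod_cast gCov_linear₀₂ C
  simp only [thetaForm_a₀, thetaForm_a₁, thetaForm_a₂]
  linear_combination (1 / 4 : K) * h1 + (s / 4) * h2 - (((C.a₁ : K) ^ 2 - (C.a₀ : K) * (C.a₂ : K)) / 4) * hs

/-- **`θ₁θ₃ = θ₂²`** — "`(αβ²)² = α²β · β³`". [cite: Bhargava2004HCL1, §3.4 (proof of Theorem 13: (αβ²)² = α²β·β³)] -/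
theorem thetaForm_a₁_mul_a₃ : (C.thetaForm s).a₁ * (C.thetaForm s).a₃ = (C.thetaForm s).a₂ ^ 2 := by
  have h1 : ((C.gCov.a₁ : K)) * (C.gCov.a₃ : K) - (C.gCov.a₂ : K) ^ 2
      = (C.disc : K) * ((C.a₂ : K) ^ 2 - (C.a₁ : K) * (C.a₃ : K)) := by
    have := congrArg (Int.cast : ℤ → K) (gCov_syzygy₁₃ C)
    push_cast at this
    simpa [hess] using this
  have h2 : (C.a₁ : K) * (C.gCov.a₃ : K) + (C.a₃ : K) * (C.gCov.a₁ : K)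
      = 2 * (C.a₂ : K) * (C.gCov.a₂ : K) := by
    exact_mod_cast gCov_linear₁₃ C
  simp only [thetaForm_a₁, thetaForm_a₂, thetaForm_a₃]
  linear_combination (1 / 4 : K) * h1 + (s / 4) * h2 - (((C.a₂ : K) ^ 2 - (C.a₁ : K) * (C.a₃ : K)) / 4) * hs

/-- **`θ₀θ₃ = θ₁θ₂`** — "`α³ · β³ = α²β · αβ²`". [folklore] -/
theorem thetaForm_a₀_mul_a₃ :
    (C.thetaForm s).a₀ * (C.thetaForm s).a₃ = (C.thetaForm s).a₁ * (C.thetaForm s).a₂ := by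
  have h1 : ((C.gCov.a₀ : K)) * (C.gCov.a₃ : K) - (C.gCov.a₁ : K) * (C.gCov.a₂ : K)
      = -((C.disc : K) * ((C.a₀ : K) * (C.a₃ : K) - (C.a₁ : K) * (C.a₂ : K))) := by
    have := congrArg (Int.cast : ℤ → K) (gCov_syzygy₀₃ C)
    push_cast at this
    simpa [hess] using this
  have h2 : (C.a₀ : K) * (C.gCov.a₃ : K) + (C.a₃ : K) * (C.gCov.a₀ : K)
      = (C.a₁ : K) * (C.gCov.a₂ : K) + (C.a₂ : K) * (C.gCov.a₁ : K) := by
    exact_mod_cast gCov_linear₀₃ C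
  simp only [thetaForm_a₀, thetaForm_a₁, thetaForm_a₂, thetaForm_a₃]
  linear_combination (1 / 4 : K) * h1 + (s / 4) * h2 + ((((C.a₀ : K) * (C.a₃ : K) - (C.a₁ : K) * (C.a₂ : K))) / 4) * hs

/-- **The system (21) with `α = θ₁`, `β = θ₂`, `δ = θ₁θ₂`**: for all `x, y ∈ K`,
`(xθ₁ + yθ₂)³ = θ₁θ₂ · (θ₀x³ + 3θ₁x²y + 3θ₂xy² + θ₃y³)`; coefficientwise `α³ = δθ₀`,
`α²β = δθ₁`, `αβ² = δθ₂`, `β³ = δθ₃` (HCL I, (21), for the representative `(α, β) = (θ₁, θ₂)` of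
(23) `α : β = θ₁ : θ₂`). [cite: Bhargava2004HCL1, §3.4 (proof of Theorem 13, eqs. (21) and (23))] -/
theorem cube_linear_eq (x y : K) :
    (x * (C.thetaForm s).a₁ + y * (C.thetaForm s).a₂) ^ 3
      = (C.thetaForm s).a₁ * (C.thetaForm s).a₂ * (C.thetaForm s).eval x y := by
  have h02 := thetaForm_a₀_mul_a₂ C hs
  have h13 := thetaForm_a₁_mul_a₃ C hs
  simp only [eval]
  linear_combination (-(x ^ 3 * (C.thetaForm s).a₁)) * h02 - (y ^ 3 * (C.thetaForm s).a₂) * h13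

/-- `α³ = δθ₀`: `θ₁³ = (θ₁θ₂) θ₀`. [cite: Bhargava2004HCL1, §3.4 (proof of Theorem 13, eq. (21))] -/
theorem thetaForm_a₁_pow_three : (C.thetaForm s).a₁ ^ 3 = (C.thetaForm s).a₁ * (C.thetaForm s).a₂ * (C.thetaForm s).a₀ := by
  have h02 := thetaForm_a₀_mul_a₂ C hs
  linear_combination (-(C.thetaForm s).a₁) * h02

/-- `β³ = δθ₃`: `θ₂³ = (θ₁θ₂) θ₃`. [cite: Bhargava2004HCL1, §3.4 (proof of Theorem 13, eq. (21))] -/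
theorem thetaForm_a₂_pow_three : (C.thetaForm s).a₂ ^ 3 = (C.thetaForm s).a₁ * (C.thetaForm s).a₂ * (C.thetaForm s).a₃ := by
  have h13 := thetaForm_a₁_mul_a₃ C hs
  linear_combination (-(C.thetaForm s).a₂) * h13

end Identities

/-- **Bhargava's `π`-description**: `2 · (θ₀x³ + 3θ₁x²y + 3θ₂xy² + θ₃y³) = g(x,y) + C(x,y)·s`, so
the `τ`-coordinate of `(xα + yβ)³/δ` is `C(x,y)` ("`C(x,y) = π((αx + βy)³/δ)`", HCL I, proof of
Thm 13). [cite: Bhargava2004HCL1, §3.4 (proof of Theorem 13, the basis-free description of C)] -/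
theorem two_mul_eval_thetaForm [CharZero K] (C : SymCubic ℤ) (s x y : K) :
    2 * (C.thetaForm s).eval x y
      = (C.gCov.map (Int.castRingHom K)).eval x y + s * (C.map (Int.castRingHom K)).eval x y := by
  simp only [eval, thetaForm, map, eq_intCast]
  ring

/-! ### Equivariance under substitutions -/

/-- **Equivariance**: `θ(C ∘ γ) = θ(C) ∘ γ` for every integral `γ` of determinant `1` (the cubic
covariant transforms like `C` under `SL₂`, `gCov_subst`): with `α' = pα + qβ`, `β' = rα + sβ`
the new values are `θ'₀ = α'³/δ, θ'₁ = α'²β'/δ, θ'₂ = α'β'²/δ, θ'₃ = β'³/δ` ("changing `α, β` to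
some other basis … via `T ∈ SL₂(ℤ)` simply changes `C(x,y)` by that same element `T`", HCL I,
proof of Thm 13). [cite: Bhargava2004HCL1, §3.4 (proof of Theorem 13, SL₂(ℤ)-equivariance)] -/
theorem thetaForm_subst (C : SymCubic ℤ) (s : K) (γ : Matrix (Fin 2) (Fin 2) ℤ) (hγ : γ.det = 1) :
    (C.subst γ).thetaForm s = (C.thetaForm s).subst (γ.map (Int.castRingHom K)) := by
  have hg := gCov_subst C γ
  rw [hγ, one_pow] at hg
  have hg₀ := congrArg SymCubic.a₀ hg
  have hg₁ := congrArg SymCubic.a₁ hg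
  have hg₂ := congrArg SymCubic.a₂ hg
  have hg₃ := congrArg SymCubic.a₃ hg
  simp only [smul_a₀, smul_a₁, smul_a₂, smul_a₃, one_mul] at hg₀ hg₁ hg₂ hg₃
  ext
  · simp only [thetaForm_a₀]
    rw [hg₀]
    simp only [subst, thetaForm_a₀, thetaForm_a₁, thetaForm_a₂, thetaForm_a₃, Matrix.map_apply,
      eq_intCast]
    push_cast
    ring
  · simp only [thetaForm_a₁]
    rw [hg₁]
    simp only [subst, thetaForm_a₀, thetaForm_a₁, thetaForm_a₂, thetaForm_a₃, Matrix.map_apply,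
      eq_intCast]
    push_cast
    ring
  · simp only [thetaForm_a₂]
    rw [hg₂]
    simp only [subst, thetaForm_a₀, thetaForm_a₁, thetaForm_a₂, thetaForm_a₃, Matrix.map_apply,
      eq_intCast]
    push_cast
    ring
  · simp only [thetaForm_a₃]
    rw [hg₃]
    simp only [subst, thetaForm_a₀, thetaForm_a₁, thetaForm_a₂, thetaForm_a₃, Matrix.map_apply,
      eq_intCast]
    push_cast
    ring

/-! ### Nonvanishing when `D` is not a square -/

section NonSquare

variable [CharZero K]

/-- In a field of characteristic `0`: if `s² = D ∈ ℤ` is not a square in `ℤ`, then `g + a·s = 0`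
with `g, a ∈ ℤ` forces `a = 0` and `g = 0` (`s` is irrational). [folklore] -/
theorem eq_zero_of_intCast_add_mul_eq_zero {D : ℤ} (hD : ¬ IsSquare D) {s : K} (hs : s ^ 2 = (D : K))
    {g a : ℤ} (h : (g : K) + (a : K) * s = 0) : a = 0 ∧ g = 0 := by
  by_cases ha : a = 0
  · subst ha
    refine ⟨rfl, ?_⟩
    simpa using h
  · exfalso
    apply hD
    have ha' : (a : K) ≠ 0 := by exact_mod_cast ha
    have hsq : s = -(g : K) / (a : K) := by
      field_simp
      linear_combination h
    have hDq : ((D : ℚ) : K) = (((-g / a : ℚ) ^ 2 : ℚ) : K) := by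
      push_cast
      rw [← hs, hsq]
    have hDq' : (D : ℚ) = (-g / a : ℚ) ^ 2 := by exact_mod_cast hDq
    exact Rat.isSquare_intCast_iff.mp ⟨-g / a, by rw [hDq', sq]⟩

variable (C : SymCubic ℤ) {s : K} (hs : s ^ 2 = (C.disc : K)) (hD : ¬ IsSquare C.disc)
include hs hD

/-- If `disc C` is not a square then `θ₀ ≠ 0` (`θ₀ = 0` forces `a₀ = 0`, `g₀ = 2a₁³ = 0`, so
`disc C = 0 = 0²`). [folklore] -/
theorem thetaForm_a₀_ne_zero : (C.thetaForm s).a₀ ≠ 0 := by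
  intro h
  rw [thetaForm_a₀, div_eq_zero_iff] at h
  rcases h with h | h
  · obtain ⟨ha, hg⟩ := eq_zero_of_intCast_add_mul_eq_zero hD hs h
    have ha₁ : C.a₁ = 0 := by
      have : 2 * C.a₁ ^ 3 = 0 := by simpa [gCov, ha] using hg
      exact pow_eq_zero_iff (n := 3) (by norm_num) |>.mp (by omega)
    apply hD
    exact ⟨0, by simp [disc, ha, ha₁]⟩
  · norm_num at h

/-- If `disc C` is not a square then `θ₁ ≠ 0` (`θ₁ = 0` forces `a₁ = 0` and `a₀a₂² = 0`, so
`disc C ∈ {0, (a₀a₃)²}`). [folklore] -/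
theorem thetaForm_a₁_ne_zero : (C.thetaForm s).a₁ ≠ 0 := by
  intro h
  rw [thetaForm_a₁, div_eq_zero_iff] at h
  rcases h with h | h
  · obtain ⟨ha, hg⟩ := eq_zero_of_intCast_add_mul_eq_zero hD hs h
    have h02 : C.a₀ * C.a₂ ^ 2 = 0 := by
      have : -(2 * (C.a₀ * C.a₂ ^ 2)) = 0 := by
        have := hg; simp only [gCov, ha] at this; linear_combination this
      linarith
    rcases mul_eq_zero.mp h02 with h0 | h2
    · exact hD ⟨0, by simp [disc, ha, h0]⟩
    · have h2' : C.a₂ = 0 := pow_eq_zero_iff (n := 2) (by norm_num) |>.mp h2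
      exact hD ⟨C.a₀ * C.a₃, by simp [disc, ha, h2']; ring⟩
  · norm_num at h

/-- If `disc C` is not a square then `θ₂ ≠ 0`. [folklore] -/
theorem thetaForm_a₂_ne_zero : (C.thetaForm s).a₂ ≠ 0 := by
  intro h
  rw [thetaForm_a₂, div_eq_zero_iff] at h
  rcases h with h | h
  · obtain ⟨ha, hg⟩ := eq_zero_of_intCast_add_mul_eq_zero hD hs h
    have h13 : C.a₁ ^ 2 * C.a₃ = 0 := by
      have : -(-(2 * (C.a₁ ^ 2 * C.a₃))) = 0 := by
        have := hg; simp only [gCov, ha] at this; linear_combination this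
      linarith
    rcases mul_eq_zero.mp h13 with h1 | h3
    · have h1' : C.a₁ = 0 := pow_eq_zero_iff (n := 2) (by norm_num) |>.mp h1
      exact hD ⟨C.a₀ * C.a₃, by simp [disc, ha, h1']; ring⟩
    · exact hD ⟨0, by simp [disc, ha, h3]⟩
  · norm_num at h

/-- If `disc C` is not a square then `θ₃ ≠ 0`. [folklore] -/
theorem thetaForm_a₃_ne_zero : (C.thetaForm s).a₃ ≠ 0 := by
  intro h
  rw [thetaForm_a₃, div_eq_zero_iff] at h
  rcases h with h | h
  · obtain ⟨ha, hg⟩ := eq_zero_of_intCast_add_mul_eq_zero hD hs h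
    have ha₂ : C.a₂ = 0 := by
      have : -(2 * C.a₂ ^ 3) = 0 := by simpa [gCov, ha] using hg
      exact pow_eq_zero_iff (n := 3) (by norm_num) |>.mp (by omega)
    apply hD
    exact ⟨0, by simp [disc, ha, ha₂]⟩
  · norm_num at h

/-- Hence `δ = θ₁θ₂ ≠ 0`. [folklore] -/
theorem thetaForm_a₁_mul_a₂_ne_zero : (C.thetaForm s).a₁ * (C.thetaForm s).a₂ ≠ 0 :=
  mul_ne_zero (thetaForm_a₁_ne_zero C hs hD) (thetaForm_a₂_ne_zero C hs hD)

end NonSquare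

end SymCubic

end Literature.NumberTheory.CubicFields
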